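import Mathlib

/-!
# Finite measures on `[0,1]` from converging discrete moments

The weak-compactness step in the proof of Hausdorff's moment theorem (a completely monotone
sequence is the moment sequence of a finite positive measure on `[0,1]`), as given in
C. Berg, J. P. R. Christensen, P. Ressel, *Harmonic Analysis on Semigroups*, Ch. 4, Prop. 6.11:
if nonnegative weights `w N j` (`0 ≤ j ≤ N`) of constant total mass `m` (for `N ≥ 1`) have discrete
moments `∑ⱼ (j/N)ⁿ w N j` converging to `a n` for every `n`, then `a n = ∫ tⁿ dμ` for a finite
positive measure `μ` carried by `[0,1]`.

Proof: the discrete measures `μ_N = ∑ⱼ w N j • δ_{j/N}` (`N ≥ 1`) have total mass `m` and live on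
the compact interval `[0,1]`, so they lie in a compact set of finite measures (weak compactness of
the positive measures of bounded mass on a compact set, BCR Ch. 2, §3; in Mathlib
`isCompact_setOf_finiteMeasure_le_of_isCompact`, the Riesz–Markov–Kakutani / Prokhorov file) and
have a weak cluster point `μ`, again carried by `[0,1]`. The moments of `μ` are read off by testing
against the bounded continuous clamped monomials `(max 0 (min t 1))ⁿ`, which agree with `tⁿ` where
all the measures live: `∫ tⁿ dμ` is a cluster point of the convergent sequence of discrete moments,
hence equals its limit `a n`.

* `exists_measure_of_discreteMoments_tendsto` — the theorem.

## References

* C. Berg, J. P. R. Christensen, P. Ressel, *Harmonic Analysis on Semigroups. Theory of Positive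
  Definite and Related Functions*, Graduate Texts in Mathematics 100, Springer (1984), Ch. 4,
  Prop. 6.11 (proof) and Ch. 2, §3 (weak compactness of Radon measures). [BergChristensenRessel1984]
* F. Hausdorff, *Summationsmethoden und Momentfolgen. I*, Math. Z. 9 (1921) 74–109.

## Mathlib

`isCompact_setOf_finiteMeasure_le_of_isCompact` (`Mathlib/MeasureTheory/Measure/Prokhorov.lean`),
`IsCompact.exists_clusterPt`, `MapClusterPt.tendsto_comp`,
`FiniteMeasure.continuous_integral_boundedContinuousFunction`,
`BoundedContinuousFunction.ofNormedAddCommGroup`, `integral_finsetSum_measure`, `integral_dirac`.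
-/

noncomputable section

open MeasureTheory Set Filter Topology
open scoped NNReal ENNReal

namespace Literature.MeasureTheory.Integral

namespace MomentsWeakCompactness

-- The helpers on finite combinations of Dirac masses and the cluster-point argument are adapted
-- from `Literature/Probability/LatticeModels/AxisSpectralRepresentationProofs.lean` (Parts C–D).

/-- A finite combination of Dirac masses `∑ⱼ cⱼ δ_{xⱼ}` evaluated on a measurable set. [folklore] -/
theorem finsetSumDirac_apply (s : Finset ℕ) (c : ℕ → ℝ) (x : ℕ → ℝ) {S : Set ℝ}
    (hS : MeasurableSet S) :
    (∑ j ∈ s, ENNReal.ofReal (c j) • Measure.dirac (x j)) S =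
      ∑ j ∈ s, ENNReal.ofReal (c j) * S.indicator 1 (x j) := by
  simp only [Measure.coe_finsetSum, Finset.sum_apply, Measure.smul_apply, smul_eq_mul,
    Measure.dirac_apply' _ hS]

/-- The total mass of a finite combination of Dirac masses `∑ⱼ cⱼ δ_{xⱼ}` with nonnegative weights
is `∑ⱼ cⱼ`. [folklore] -/
theorem finsetSumDirac_univ (s : Finset ℕ) (c : ℕ → ℝ) (x : ℕ → ℝ) (hc : ∀ j ∈ s, 0 ≤ c j) :
    (∑ j ∈ s, ENNReal.ofReal (c j) • Measure.dirac (x j)) univ = ENNReal.ofReal (∑ j ∈ s, c j) := by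
  rw [finsetSumDirac_apply s c x MeasurableSet.univ, ENNReal.ofReal_sum_of_nonneg hc]
  refine Finset.sum_congr rfl fun j _ => ?_
  rw [indicator_of_mem (mem_univ _), Pi.one_apply, mul_one]

/-- A finite combination of Dirac masses at points of a measurable set `S` gives no mass to `Sᶜ`.
[folklore] -/
theorem finsetSumDirac_compl_eq_zero (s : Finset ℕ) (c : ℕ → ℝ) (x : ℕ → ℝ) {S : Set ℝ}
    (hS : MeasurableSet S) (hx : ∀ j ∈ s, x j ∈ S) :
    (∑ j ∈ s, ENNReal.ofReal (c j) • Measure.dirac (x j)) Sᶜ = 0 := by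
  rw [finsetSumDirac_apply s c x hS.compl]
  refine Finset.sum_eq_zero fun j hj => ?_
  rw [indicator_of_notMem (notMem_compl_iff.2 (hx j hj)), mul_zero]

/-- The integral against a finite combination of Dirac masses `∑ⱼ cⱼ δ_{xⱼ}` with nonnegative
weights is the weighted sum of point evaluations `∑ⱼ cⱼ g(xⱼ)` (every real function is integrable
against a Dirac mass on `ℝ`, being a.e. constant). [folklore] -/
theorem integral_finsetSumDirac (s : Finset ℕ) (c : ℕ → ℝ) (x : ℕ → ℝ) (hc : ∀ j ∈ s, 0 ≤ c j)
    (g : ℝ → ℝ) :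
    ∫ t, g t ∂(∑ j ∈ s, ENNReal.ofReal (c j) • Measure.dirac (x j)) = ∑ j ∈ s, c j * g (x j) := by
  rw [integral_finsetSum_measure fun j _ =>
    ((integrable_const (g (x j))).congr (ae_eq_dirac g).symm).smul_measure ENNReal.ofReal_ne_top]
  refine Finset.sum_congr rfl fun j hj => ?_
  rw [integral_smul_measure, integral_dirac, ENNReal.toReal_ofReal (hc j hj), smul_eq_mul]

/-- The nodes `j/N`, `0 ≤ j ≤ N`, lie in `[0,1]` (also for `N = 0`, where `j/N = 0`). [folklore] -/
theorem node_mem_Icc {N j : ℕ} (hj : j ∈ Finset.range (N + 1)) :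
    (j : ℝ) / (N : ℝ) ∈ Icc (0 : ℝ) 1 :=
  ⟨div_nonneg (Nat.cast_nonneg _) (Nat.cast_nonneg _),
    div_le_one_of_le₀ (by exact_mod_cast Nat.lt_succ_iff.mp (Finset.mem_range.mp hj))
      (Nat.cast_nonneg _)⟩

/-- Clamped monomials as bounded continuous functions: some `g ∈ C_b(ℝ)` (namely
`(max 0 (min t 1))ⁿ`) agrees with `tⁿ` on `[0,1]`. [folklore] -/
theorem exists_bcf_eq_pow (n : ℕ) :
    ∃ g : BoundedContinuousFunction ℝ ℝ, ∀ t ∈ Icc (0 : ℝ) 1, g t = t ^ n := by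
  refine ⟨BoundedContinuousFunction.ofNormedAddCommGroup (fun t => (max 0 (min t 1)) ^ n)
    ((continuous_const.max (continuous_id.min continuous_const)).pow n) 1 fun t => ?_,
    fun t ht => ?_⟩
  · have h0 : 0 ≤ max 0 (min t 1) := le_max_left _ _
    have h1 : max 0 (min t 1) ≤ 1 := max_le zero_le_one (min_le_right _ _)
    rw [Real.norm_eq_abs, abs_pow, abs_of_nonneg h0]
    exact pow_le_one₀ h0 h1
  · simp only [BoundedContinuousFunction.coe_ofNormedAddCommGroup]
    rw [min_eq_left ht.2, max_eq_right ht.1]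

/-- A measure giving no mass to `[0,1]ᶜ` is carried by `[0,1]`: almost every point lies in `[0,1]`.
[folklore] -/
theorem ae_mem_Icc {ν : Measure ℝ} (hν : ν (Icc (0 : ℝ) 1)ᶜ = 0) : ∀ᵐ t ∂ν, t ∈ Icc (0 : ℝ) 1 :=
  (measure_eq_zero_iff_ae_notMem.1 hν).mono fun _ ht => of_not_not ht

/-- On a measure carried by `[0,1]`, a function agreeing with `tⁿ` on `[0,1]` has the same integral
as `tⁿ`. [folklore] -/
theorem integral_eq_of_eqOn_Icc {ν : Measure ℝ} (hν : ν (Icc (0 : ℝ) 1)ᶜ = 0) {g : ℝ → ℝ} {n : ℕ}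
    (hg : ∀ t ∈ Icc (0 : ℝ) 1, g t = t ^ n) : ∫ t, g t ∂ν = ∫ t, t ^ n ∂ν := by
  refine integral_congr_ae ?_
  filter_upwards [ae_mem_Icc hν] with t ht
  exact hg t ht

end MomentsWeakCompactness

open MomentsWeakCompactness in
/-- **Finite measures on `[0,1]` from converging discrete moments** (the weak-compactness step of
Hausdorff's moment theorem). Let `w N j ≥ 0` (`0 ≤ j ≤ N`) be weights of constant total mass
`∑ⱼ w N j = m` for `N ≥ 1`, whose discrete moments `∑ⱼ (j/N)ⁿ w N j` converge, as `N → ∞`, to `a n`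
for every `n`. Then there is a finite positive measure `μ` on `ℝ` carried by `[0,1]` with
`a n = ∫ tⁿ dμ` for all `n`. Proof: the discrete measures `∑ⱼ w N j • δ_{j/N}` have mass `m` and
live on the compact `[0,1]`, hence have a weak cluster point (weak compactness of positive measures
of bounded mass on a compact set), carried by `[0,1]`, whose moments are read off on the bounded
continuous clamped monomials `(max 0 (min t 1))ⁿ`.
[cite: BergChristensenRessel1984, Ch. 4, Prop. 6.11 (proof); Ch. 2, §3 (weak compactness)] -/
theorem exists_measure_of_discreteMoments_tendsto (a : ℕ → ℝ) (w : ℕ → ℕ → ℝ) (m : ℝ)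
    (hw : ∀ N j, 0 ≤ w N j) (hmass : ∀ N, 1 ≤ N → ∑ j ∈ Finset.range (N + 1), w N j = m)
    (hmom : ∀ n : ℕ, Tendsto (fun N : ℕ => ∑ j ∈ Finset.range (N + 1), ((j : ℝ) / (N : ℝ)) ^ n * w N j)
      atTop (𝓝 (a n))) :
    ∃ μ : Measure ℝ, IsFiniteMeasure μ ∧ μ (Set.Icc (0 : ℝ) 1)ᶜ = 0 ∧ ∀ n : ℕ, a n = ∫ t, t ^ n ∂μ := by
  classical
  /- Step 1: the discrete measures `ν N := μ_{N+1} = ∑_{j ≤ N+1} w (N+1) j • δ_{j/(N+1)}` (the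
  index is shifted by one so that every term has total mass exactly `m`); they are finite, carried
  by `[0,1]`, and integrate a function `g` to `∑ⱼ w (N+1) j g(j/(N+1))`. -/
  let ν : ℕ → Measure ℝ := fun N => ∑ j ∈ Finset.range (N + 1 + 1),
    ENNReal.ofReal (w (N + 1) j) • Measure.dirac ((j : ℝ) / ((N + 1 : ℕ) : ℝ))
  have hνmass : ∀ N, ν N univ = ENNReal.ofReal m := fun N => by
    show (∑ j ∈ Finset.range (N + 1 + 1),
      ENNReal.ofReal (w (N + 1) j) • Measure.dirac ((j : ℝ) / ((N + 1 : ℕ) : ℝ))) univ = _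
    rw [finsetSumDirac_univ _ _ _ fun j _ => hw _ j, hmass (N + 1) (Nat.le_add_left 1 N)]
  have hνsupp : ∀ N, ν N (Icc (0 : ℝ) 1)ᶜ = 0 := fun N =>
    finsetSumDirac_compl_eq_zero (Finset.range (N + 1 + 1)) (w (N + 1))
      (fun j : ℕ => (j : ℝ) / ((N + 1 : ℕ) : ℝ)) measurableSet_Icc fun _ hj => node_mem_Icc hj
  have hνint : ∀ N (g : ℝ → ℝ), ∫ t, g t ∂(ν N) =
      ∑ j ∈ Finset.range (N + 1 + 1), w (N + 1) j * g ((j : ℝ) / ((N + 1 : ℕ) : ℝ)) := fun N g =>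
    integral_finsetSumDirac (Finset.range (N + 1 + 1)) (w (N + 1))
      (fun j : ℕ => (j : ℝ) / ((N + 1 : ℕ) : ℝ)) (fun j _ => hw _ j) g
  have hνfin : ∀ N, IsFiniteMeasure (ν N) := fun N =>
    ⟨by rw [hνmass]; exact ENNReal.ofReal_lt_top⟩
  /- Step 2: a weak cluster point `μ` in the compact set of finite measures of mass `≤ m` carried by
  the compact interval `[0,1]` (Mathlib's `isCompact_setOf_finiteMeasure_le_of_isCompact`). -/
  let ρ : ℕ → FiniteMeasure ℝ := fun N => ⟨ν N, hνfin N⟩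
  have hρcoe : ∀ N, ((ρ N : FiniteMeasure ℝ) : Measure ℝ) = ν N := fun N => rfl
  set S : Set (FiniteMeasure ℝ) := {μ | μ.mass ≤ m.toNNReal ∧ μ (Icc (0 : ℝ) 1)ᶜ = 0} with hSdef
  have hS : IsCompact S := isCompact_setOf_finiteMeasure_le_of_isCompact _ isCompact_Icc
  have hρS : ∀ N, ρ N ∈ S := by
    intro N
    constructor
    · have h : ((ρ N).mass : ℝ≥0∞) ≤ (m.toNNReal : ℝ≥0∞) := by
        rw [FiniteMeasure.ennreal_mass, hρcoe, hνmass, ENNReal.ofNNReal_toNNReal]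
      exact ENNReal.coe_le_coe.1 h
    · rw [FiniteMeasure.null_iff_toMeasure_null, hρcoe]
      exact hνsupp N
  have hleS : (atTop : Filter ℕ).map ρ ≤ 𝓟 S :=
    le_principal_iff.2 (mem_map.2 (univ_mem' fun N => hρS N))
  obtain ⟨μ, hμS, hclu⟩ := hS.exists_clusterPt hleS
  have hclu' : MapClusterPt μ atTop ρ := hclu
  have hμsupp : (μ : Measure ℝ) (Icc (0 : ℝ) 1)ᶜ = 0 :=
    (FiniteMeasure.null_iff_toMeasure_null _ _).1 hμS.2
  refine ⟨μ, inferInstance, hμsupp, fun n => ?_⟩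
  /- Step 3: the moments of the cluster point. Test against a bounded continuous `g` agreeing with
  `tⁿ` on `[0,1]`: `∫ g dμ` is a cluster point of the sequence
  `N ↦ ∫ g dμ_{N+1} = ∑ⱼ (j/(N+1))ⁿ w (N+1) j → a n`, hence equals `a n`. -/
  obtain ⟨g, hg⟩ := exists_bcf_eq_pow n
  have hgclu : MapClusterPt (∫ t, g t ∂(μ : Measure ℝ)) atTop
      (fun N => ∫ t, g t ∂(ρ N : Measure ℝ)) :=
    hclu'.tendsto_comp ((FiniteMeasure.continuous_integral_boundedContinuousFunction g).tendsto μ)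
  have hgN : (fun N => ∫ t, g t ∂(ρ N : Measure ℝ)) = fun N =>
      ∑ j ∈ Finset.range (N + 1 + 1), ((j : ℝ) / ((N + 1 : ℕ) : ℝ)) ^ n * w (N + 1) j := by
    funext N
    rw [hρcoe, hνint]
    refine Finset.sum_congr rfl fun j hj => ?_
    rw [hg _ (node_mem_Icc hj), mul_comm]
  have hglim : Tendsto (fun N => ∫ t, g t ∂(ρ N : Measure ℝ)) atTop (𝓝 (a n)) := by
    rw [hgN]
    exact (hmom n).comp (tendsto_add_atTop_nat 1)
  -- a real cluster point of a convergent real sequence is its limit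
  rw [← integral_eq_of_eqOn_Icc hμsupp hg]
  exact (eq_of_nhds_neBot (hgclu.clusterPt.mono hglim)).symm

end Literature.MeasureTheory.Integral

end
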